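import Summits.HodgeConjecture.CorCM.GaloisTwiceOddDegenerateTypes
import Literature.AlgebraicGeometry.ComplexMultiplication.EndomorphismFieldNondegenerateType
import Literature.NumberTheory.ComplexMultiplication.ShimuraTaniyamaHecke
import Summits.HodgeConjecture.HodgeConjecture.Theorems.Ring2ClassTargets
import HarnessLib

/-!
# Galois CM fields of degree `2m`, `m` odd: ALL abelian varieties with complex multiplication by `K` are stably
# nondegenerate iff `m` is prime

COR-CM (cell `pub-hodgecm2`), binder seat b04 (gen 21), count-neutral claim TWICE-ODD-ALLTYPES — the all-types form of
gen 19's twice-odd theorem (`TwiceOdd.forall_isSimple_isNondegenerate_iff_of_twice_odd`: `K/ℚ` Galois CM of degree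
`2m`, `m` odd, `m ≠ 1`: every SIMPLE abelian variety with CM by `K` is nondegenerate ⟺ `m` prime).  KERNEL ONLY:
theorems; no definition, no named fact, no `sorry`.  `HC_CM` is neither used nor claimed.

For `m` prime the dimension `m = dim X` is prime, so EVERY `X` with `K ↪ End⁰(X)`, `[K:ℚ] = 2 dim X`, is stably
nondegenerate by lit-hodgefound's `EndFieldFullDegree.isStablyNondegenerate_of_prime` (Tankeev–Ribet–Yanai with the
primitive core: non-simple `X ∼ Eᵐ`), with NO hypothesis on `K` at all; for `m` composite gen 19 supplies a SIMPLE
degenerate variety.  So the simple classification IS the all-X classification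
(**`forall_isStablyNondegenerate_iff_of_twice_odd`**), completing the twice-odd row.

## References

* [Yanai1985] H. Yanai, *On the rank of CM-type*, Nagoya Math. J. 97 (1985), §4 Theorem and Remark (p. 172).
* [Dodson1984] B. Dodson, *The structure of Galois groups of CM-fields*, Trans. AMS 283 (1984), §3.2.1.
* [Gordon1999HodgeAVSurvey] B. B. Gordon, *A survey of the Hodge conjecture for abelian varieties*, Thm. 6.3–6.4.
* [Shimura1998] G. Shimura, *Abelian Varieties with Complex Multiplication and Modular Functions*, §6.2 Thm. 3, §8.2
  Prop. 26.
-/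

noncomputable section

open CategoryTheory CategoryTheory.Limits NumberField

namespace Summit.HodgeConjecture.CorCM.TwiceOddAllTypes

open Literature.NumberTheory.ComplexMultiplication
open Literature.AlgebraicGeometry Literature.AlgebraicGeometry.Motives Literature.AlgebraicGeometry.HodgeTheory
open Literature.AlgebraicGeometry.Motives.AbelianVariety
open Literature.AlgebraicGeometry.ComplexMultiplication
open Literature.AlgebraicGeometry.Pohlmann1968
open Summit.HodgeConjecture.HodgeConjecture.Ring2.ClassTargets
open Summit.HodgeConjecture.CorCM.TwiceOdd (forall_isPrimitive_isNondegenerate_iff_of_twice_odd)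

variable {K : Type} [Field K] [NumberField K] [IsCMField K]

omit [IsCMField K] in
/-- **`m` prime: every abelian variety of dimension `m` with a CM field of degree `2m` in `End⁰` is stably
nondegenerate** — no Galois hypothesis, no simplicity (Tankeev–Ribet–Yanai on the primitive core; lit-hodgefound's
`EndFieldFullDegree.isStablyNondegenerate_of_prime`, read with `[K:ℚ] = 2m`). [cite: Yanai1985, §4 Theorem and Remark (p. 172)]
[cite: Gordon1999HodgeAVSurvey, Thm. 6.3 with Remark] -/
theorem isStablyNondegenerate_of_twice_prime {p : ℕ} (hp : p.Prime) (hK : Module.finrank ℚ K = 2 * p)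
    {X : AbelianVariety ℂ} (φ : K →+* X.endAlgebra) (hX : Module.finrank ℚ K = 2 * X.dim) :
    IsStablyNondegenerate X :=
  EndFieldFullDegree.isStablyNondegenerate_of_prime φ hX ((show X.dim = p by omega) ▸ hp)

/-- **THE CLASSIFICATION (twice-odd degree, all abelian varieties).**  `K/ℚ` Galois CM of degree `2m`, `m` odd,
`m ≠ 1`: EVERY complex abelian variety `X` with `K ↪ End⁰(X)`, `[K:ℚ] = 2 dim X`, is stably nondegenerate ⟺ `m` is
prime — the same as for SIMPLE varieties (gen 19). (⇒: a simple degenerate variety for composite `m`, Hazama.)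
[cite: Yanai1985, §4 Theorem] [cite: Dodson1984, §3.2.1] [cite: Gordon1999HodgeAVSurvey, Thm. 6.4]
[cite: Shimura1998, §6.2 Thm. 3 and §8.2 Prop. 26] -/
theorem forall_isStablyNondegenerate_iff_of_twice_odd [IsGalois ℚ K] {m : ℕ} (hm : Odd m) (hm1 : m ≠ 1)
    (hK : Module.finrank ℚ K = 2 * m) :
    (∀ (X : AbelianVariety ℂ) (_ : K →+* X.endAlgebra), Module.finrank ℚ K = 2 * X.dim → IsStablyNondegenerate X) ↔
      m.Prime := by
  refine ⟨fun h => ?_, fun hp X φ hX => isStablyNondegenerate_of_twice_prime hp hK φ hX⟩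
  obtain ⟨φ₀⟩ := (inferInstance : Nonempty (K →+* ℂ))
  rw [← forall_isPrimitive_isNondegenerate_iff_of_twice_odd hm hm1 hK φ₀]
  intro Ψ hprim
  obtain ⟨B, ιB, θB, hB⟩ := exists_isCMTypeRealisation_of_realised
    Summit.HodgeConjecture.CorCM.cmAbelianVarietyRealised_holds K Ψ
  obtain ⟨i, -⟩ := exists_ringHom_endAlgebra ιB
  exact (isStablyNondegenerate_iff_isNondegenerate φ₀ hprim hB).1
    (h B i (finrank_eq_two_mul_dim_of_isCMTypeRealisation hB))

/-- **The same in the realisation vocabulary**: every abelian variety `(A, ι)` of ANY CM type `(K; Φ)` is stably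
nondegenerate ⟺ `m` prime. [cite: Gordon1999HodgeAVSurvey, Thm. 6.4] [cite: Shimura1998, §8.2 Prop. 26] -/
theorem forall_realisation_isStablyNondegenerate_iff_of_twice_odd [IsGalois ℚ K] {m : ℕ} (hm : Odd m) (hm1 : m ≠ 1)
    (hK : Module.finrank ℚ K = 2 * m) :
    (∀ (Φ : CMType K) (A : AbelianVariety ℂ) (ι : 𝓞 K →+* End A) (θ : K →+* Module.End ℂ (complexBetti A.X 1)),
        IsCMTypeRealisation Φ A ι θ → IsStablyNondegenerate A) ↔ m.Prime := by
  rw [← forall_isStablyNondegenerate_iff_of_twice_odd hm hm1 hK]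
  constructor
  · intro h X i hX
    obtain ⟨X', φ', ι', hφι, f, hf⟩ := exists_principal_pair i
    have hdim' : Module.finrank ℚ K = 2 * X'.dim := by rw [← dim_eq_of_isIsogeny hf, hX]
    exact (h _ X' ι' _ (isCMTypeRealisation_cmTypeOfPair φ' hdim' ι' hφι)).of_isIsogenous ⟨f, hf⟩
  · intro h Φ A ι θ hA
    obtain ⟨i, -⟩ := exists_ringHom_endAlgebra ι
    exact h A i (finrank_eq_two_mul_dim_of_isCMTypeRealisation hA)

variable {Φ : CMType K} {A : AbelianVariety ℂ} {ι : 𝓞 K →+* End A} {θ : K →+* Module.End ℂ (complexBetti A.X 1)}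

omit [IsCMField K] in
/-- **The Hodge conjecture for every power of EVERY abelian variety with CM by a CM field of degree `2p`** (`p` prime;
no Galois hypothesis, no simplicity — gen 19's `hodgeConjectureFor_pow_of_isSimple_of_twice_odd_prime` upgraded).
[cite: Gordon1999HodgeAVSurvey, Thm. 6.3 with Remark] [cite: Yanai1985, Remark (p. 172)] -/
theorem hodgeConjectureFor_pow_of_twice_prime {p : ℕ} (hp : p.Prime) (hK : Module.finrank ℚ K = 2 * p)
    (hA : IsCMTypeRealisation Φ A ι θ) (N : ℕ) :
    HodgeConjectureFor (⨁ fun _ : Fin N => A).dim (⨁ fun _ : Fin N => A).X := by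
  obtain ⟨i, -⟩ := exists_ringHom_endAlgebra ι
  exact hodgeConjectureFor_of_isDivisorGenerated _
    ((isStablyNondegenerate_iff_forall_isDivisorGenerated_biproduct A).1
      (isStablyNondegenerate_of_twice_prime hp hK i (finrank_eq_two_mul_dim_of_isCMTypeRealisation hA)) N)

/-- **HC on the class «isogenous to a power of an abelian variety `X` with a CM field of degree `2p = 2 dim X` in
`End⁰(X)`, `p` prime»** — UNCONDITIONAL (no Galois hypothesis, no simplicity). [cite: Gordon1999HodgeAVSurvey, Thm. 6.3] -/
theorem hcOnClass_isIsogenous_powSucc_cmField_twice_prime :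
    HCOnClass fun B ↦ ∃ (X : AbelianVariety ℂ) (N : ℕ) (K : Type) (_ : Field K) (_ : NumberField K)
      (_ : IsCMField K) (p : ℕ), p.Prime ∧ Module.finrank ℚ K = 2 * p ∧ Module.finrank ℚ K = 2 * X.dim ∧
      Nonempty (K →+* X.endAlgebra) ∧ IsIsogenous B (X.powSucc N) := by
  rintro B ⟨X, N, K, _, _, _, p, hp, hK, hX, ⟨φ⟩, h⟩
  exact (isStablyNondegenerate_of_twice_prime hp hK φ hX).hodgeConjectureFor_of_isIsogenous_powSucc h

end Summit.HodgeConjecture.CorCM.TwiceOddAllTypes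

end
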